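import Summits.BirchSwinnertonDyer.BirchSwinnertonDyer.Theorems.SignedBaseChangeDefiniteAnchorDefs
import Summits.BirchSwinnertonDyer.BirchSwinnertonDyer.Theorems.SignedBaseChangeAnticyclotomicEisensteinDivisibilityAdmdefAnchorIffNV
import Literature.NumberTheory.EllipticCurves.ZpExtensionEisensteinConjugationDatumProofs
import HarnessLib

/-!
# Disproof of `DefiniteAnchorNonFW` (stmt-BirchSwinnertonDyer-33118, route `SignedBaseChange`, line `admdef` of crux 20727) — findings

Crux `S := Theorems.SignedBaseChangeDefiniteAnchorDefs.DefiniteAnchorNonFW` (K1, «(Anch)_¬FW»): on cell β — `E/ℚ` elliptic, globally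
minimal `W`, newform `f` of level `N = N_E` (`IsNewformOf W f`), `p ≥ 5` good SUPERSINGULAR (`a_p = 0`), `ρ̄_{E,p}` onto, `K` imaginary
quadratic with `p` split, every `ℓ ∣ N` split, `(N, d_K) = 1`, `p ∤ h_K`, `N` NOT square-free, `E[p]` ramified at every `q ∣ N`, OFF the
Fouquet–Wan locus — at EVERY odd level `n` of Bertolini–Darmon admissible primes with BOTH eigen-Selmer spaces `Sel_n^± = 0`
(`AdditiveKoly.SelQP W K p c n μ = ⊥`), there are a definite Brandt set-up `S : XiSetup N (∏ n)`, a Gross point `(ψ, I)` and a mod-`p`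
`a(E)`-eigenvector `φ` with NON-ZERO WEIGHTED toric period (`AnchorAt`, §0).

VERDICT OF GENERATION 0 (cdisprove seat, 2026-08-30): **NO KILL.**  `S` is a believed-true open statement — the rank-0 mod-`℘` converse ∕
«BSD unit» for the non-ordinary level-raised definite forms `g_n` at NON-square-free level; by the LEAD's kernel theorem
`…AdmdefAnchorIffNV.hasUnitLambda_iff_forall_anchor` it is, modulo CHKLL25's frame (signed bipartite system `hB`, `Setting`, {HLV 3.7 local},
dictionary `hdict`, multiplicity one `hmult`), EQUIVALENT to Howard's non-vanishing hypothesis [NV] `B.HasUnitLambda N` — Kolyvagin's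
conjecture in bipartite currency, a theorem in print only under square-free ∕ ordinary hypotheses (W. Zhang 2014 Thm. 9.1 ordinary;
CHKLL25 Thm. 7.6 square-free; Sweeting 2020+ patched systems, still with local hypotheses at `q² ∣ N`).  No in-tree counter-instance CAN
exist: the `∀`-binders `IsNewformOf W f` (a genuine `CuspForm Γ₀(N) 2` with `a_n(f) = a_n(E)`), `Surj W p`, binder (ii) and `SelQP … = ⊥` have no
constructible inhabitant in Mathlib ∕ the tree (kit budget 0: no Brandt module at level `N·q`, `N` non-square-free, with a certified `Sel_q = 0`
was computed).  What IS recorded below is kernel-checked (`sorry`-free, standard axioms) unless its docstring says CONJECTURAL.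

## Index of findings

* §0 `AnchorAt` + `definiteAnchorNonFW_iff` — the crux restated with its conclusion named (definitional, `Iff.rfl`).
* §1 TYPING AUDIT (docstring of `definiteAnchorNonFW_iff`): every binder and the conclusion read back symbol by symbol; NO junk found
  (`XiSetup` demands `IsQuaternionAlgebra`, `IsTotallyDefinite`, `IsEichlerOrder`; `eigenSpace` is the anemic `T_ℓ`-eigenspace off `N·∏n`;
  `toricPeriod` is Gross's `∑_{Pic(𝓞_K)}`; weights `w_i = [O_iˣ : ℤˣ]`; `primesAbove`, `inertia`, `FWNonsplitRam` honest).
* §2 BINDERS THAT ARE NOT LOAD-BEARING (kernel):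
  - `withoutFiveLe_iff` — `5 ≤ p` is REDUNDANT: for a prime `p < 5` there are no admissible primes (`three_lt_of_isAdmissiblePrime`), so every
    level is `∅`, never odd; the crux with `5 ≤ p →` deleted is EQUIVALENT to the crux.
  - `atOne_of` — `c ≠ 1` protects nothing: at `c = 1` the `+`-space is the sign-free level space and dominates every `SelQP c n μ`
    (`selQP_le_selQP_one_true`), so the `c = 1` instance of the body FOLLOWS from the crux (via the genuine conjugation, which exists:
    `IsImaginaryQuadratic.exists_algEquiv_ne_one_mul_self`).  The conclusion does not mention `c`.
  - `withoutNewform_iff` — the binder pair `(f, IsNewformOf W f)` is DECORATION modulo the modularity fact `exists_isNewformOf`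
    (Wiles–BCDT, named fact of `CuspFormLFunction.lean`): nothing else in `S` mentions `f`.
  - `onBeta_iff` — the Fouquet–Wan cut is a PARTITION: «(Anch) on all of β» ⟺ `DefiniteAnchorFW ∧ DefiniteAnchorNonFW`.
* §3 BINDERS THAT ARE LOAD-BEARING:
  - `not_anchorAt_of_even_card` (kernel, unconditional) — the conclusion is UNSATISFIABLE at even levels: a set-up of type `(N, ∏n)` forces
    `ω(∏n) = #n` odd (`XiSetup.odd_card_primeFactors`, Hilbert reciprocity over `ℚ`).  So `Odd n.card` cannot be dropped as typed; but it is
    also IMPLIED on β by the zero-vertex hypothesis (Gross–Parson parity `dim Sel_n ≡ dim Sel_∅ + #n`, `dim Sel_∅` odd by (Par) = Cassels–Tate +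
    Dokchitser–Dokchitser; tree: raising half `…AdmdefSignedDetour.finrank_selQP_insert_eq_one`, (Par) `…AdmdefOddSelmerDim`) — CONJECTURAL label
    only for the full parity lemma, which the tree does not hold at arbitrary vertices.
  - ★ `selQP_eq_bot_of_anchorAt` (kernel, modulo CHKLL25's frame as HYPOTHESES) — **the anchor at an odd level `s` IMPLIES its own zero-vertex
    hypothesis at `s`**: anchor ⟹ `λ_1(∏s)(0) ∈ ℤ_pˣ` and [NV] (`hasUnitLambda_of_anchorAt`, needs `hdict`, `hmult`) ⟹ `Sel_s^± = 0` (Howard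
    3.2.3 (c) as an iff, `isUnit_lam_iff_selQP_eq_bot_of_hasUnitLambda'`).  Hence
    ★ `withoutSelZero_false_of_selQP_ne_bot` — the director's target (a) `_false_without_selZero`: the crux with the binder
    `(∀ μ, SelQP W K p c n μ = ⊥) →` deleted is FALSE as soon as ONE cell-β datum in the frame has ONE odd level `s` with `Sel_s^μ ≠ 0`
    (e.g. any `(E, K, p)` on β with `dim_𝔽_p Sel_p(E/K) ≥ 3`: then `dim Sel_q ≥ 2` at every admissible `q` — CONJECTURAL instance, not
    certified here).  ANY PROOF OF `S` MUST USE `Sel_n^± = 0`.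
* §4 THE ROOT-ZERO SUB-LOCUS (director's target (b); prose + pointers, nothing new to land): by the LEAD's
  `…AdmdefRootDichotomy.hasUnitLambda_of_rootDichotomy` ∕ `…AdmdefUnitLambdaOfLoc.hasUnitLambda_of_limitBaseClass_res_ne_zero`, [NV] is KERNEL
  (modulo frame) wherever the bottom class `z_{0,1} = δ(−2·y_K) mod p` is visible at ONE admissible Frobenius; there `S`'s conclusion follows
  from `anchor_of_hasUnitLambda` — no refutation target.  `S` carries content only on (NP) «`y_K ∈ p·E(K)` at every admissible Frobenius»,
  i.e. `p ∣ [E(K) : ℤ y_K]` in the Selmer sense or `r_an(E/K) ≥ 3`; a counterexample to `S` would be a level-raised definite newform `g_n`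
  (level `N·∏n`, `N` non-square-free, no `ρ̄`-ramified non-split Steinberg prime) with `Sel_{℘_n}(A_{g_n}/K) = 0` but `L^{alg}(g_n/K, 1) ≡ 0
  (mod ℘_n)` — a failure of the rank-0 BSD formula mod `℘` for `g_n`; Tamagawa obstructions are excluded on β by binder (ii) (`c_q ≤ 4 < p` at
  additive `q`, `p ∤ c_q(A_{g_n})`), and no such failure is known in print.  CONJECTURAL assessment; no certificate either way.
* §5 WHY IT RESISTS (for provers, prose in `withoutSelZero_false_of_selQP_ne_bot`'s docstring): no finite computation refutes `S` without
  (i) a Brandt module at non-square-free level `N·q` over `𝔽_p`, (ii) a CERTIFIED `Sel_q(E[p]/K) = 0`, (iii) Gross points and weights — (ii)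
  has no certified implementation; kit budget of this seat is 0.
* §6 PRINT MAP of cell β ∖ FW (prose; page hits from the materialised texts, read 2026-08-30; CONJECTURAL as far as the kernel goes):
  - Binder (ii) «`E[p]` ramified at every `q ∣ N`» is LOAD-BEARING IN PRINT at multiplicative `q`, and only there: it is W. Zhang's
    Hypothesis ♠ (1) «`Ram(ρ̄_{E,p}) ⊇ {ℓ ‖ N⁺}`» [WZhang2014, p. 195], and without it the mod-`p` classes ∕ periods may ALL vanish — Sweeting
    proves Kolyvagin's conjecture only in the form `∃ M, c_M(n) ≠ 0` «even when every class `c_1(n)` may vanish» [Sweeting2020, arXiv:2012.11771,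
    p. 3, Thm. 1.1] (Tamagawa ∕ level-lowering obstruction: `v_℘(L(g/K,1)/Ω_g) = lg Sel_{℘^∞}(A_g/K) + ∑_{ℓ∣N} t_g(ℓ)` [Sweeting2020, Thm. 10.2],
    `t_g(ℓ) > 0` iff `ρ̄` unramified at `ℓ ‖ N`).  At ADDITIVE `q` (`q² ∣ N`) binder (ii) is automatic for `p ≥ 5` (inertia acts on `T_p E` through a
    finite group of order dividing `24`, prime to `p`, on which reduction mod `p` is injective; potentially multiplicative: the ramified quadratic
    character survives mod `p`) and Zhang needs nothing there: «no requirement on the ramification of `E[p]` at primes `ℓ² ∣ N`» [WZhang2014, p. 195].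
    So `S` WITHOUT binder (ii) is false in print (class: misstated-if-dropped), and WITH it the known vanishing mechanism is excluded — consistent
    with NO KILL.
  - Where `S` is essentially IN PRINT: the sub-cell with at least TWO (split, `ρ̄`-ramified) multiplicative primes `ℓ ‖ N` is covered by Zhang's
    Hypothesis ♠ (2) «if `N` is not square-free then `#Ram ≥ 1` and … at least two primes `ℓ ‖ N⁺`» [WZhang2014, p. 195, Thm. 1.1 ⇒ Thm. 9.3], whose
    proof passes through the unit toric period at a Selmer-zero definite vertex (Gross formula + Ribet–Takahashi∕Khare∕Pollack–Weston period
    comparison, [WZhang2014, Thm. 6.4, pp. 229–230] — ♠ (2) is used exactly there); ordinarity enters only through the rank-0 BSD formula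
    (Skinner–Urban), «since proven in the supersingular case by Wan» [Sweeting2020, Rem. 1.2; Thm. 10.2 with the supersingular proviso «at least
    one `ℓ ‖ N` with local sign `ε_ℓ = 1`»].
  - Where `S` is GENUINELY OPEN (the research kernel of this crux): `N` non-square-free with AT MOST ONE multiplicative prime — in particular
    square-full `N` (every bad prime additive; non-CM examples abound, e.g. conductor `121`, `225`, `392`, `400`, `441`), where the level-raised
    forms `g_n` have NO `ρ̄`-ramified Steinberg prime, so neither the Ribet–Takahashi comparison nor the Skinner–Urban∕Wan rank-0 formula is
    available for `g_n/K`.  No obstruction is known there either (Agashe–Ribet–Stein: congruence number and modular degree agree at `p` when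
    `p² ∤ 4N`, which holds as `p ∤ N`); a counterexample would be a failure of the mod-`℘` rank-0 BSD∕Gross-period unit for a non-ordinary
    `g_n` — not predicted by any conjecture.  Combined with §4: the open kernel is (≤ 1 multiplicative prime) × (NP: `y_K ∈ p·E(K)` at every
    admissible Frobenius); everywhere else `S` is print-or-kernel modulo the frame.

HONEST FRAMING: theorems only about the TEXT of `S` and its variants; the frame of §3 (`hB`, `hS`, `hloc`, `hdict`, `hmult`, (Par)) is a
HYPOTHESIS wherever it appears; nothing here proves or refutes `S`, [NV], the crux 20727 or BSD.

References: [cite: Howard2006, Thm. 3.2.3 (c)] [cite: CastellaEtAl2025, Thm. 7.4, Thm. 7.5, Thm. 7.6, §7.4] [cite: WZhang2014, p. 195, Thm. 1.1, Thm. 6.4, Prop. 5.4, Thm. 9.1, Thm. 9.3]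
[cite: Sweeting2020, arXiv:2012.11771, p. 3, Thm. 1.1, Rem. 1.2, Thm. 10.2] [cite: BertoliniDarmon2005, p. 18, p. 22] [cite: VignerasLNM800, Ch. III §3 Thm. 3.1]
[cite: GrossParson2012, Lemma 9] [cite: KimOta2023, Thm. 5.5] [cite: AgasheRibetStein2012, Thm. 2.1]
-/

-- D-0017: single-problem summit, the namespace repeats the problem name by design.
set_option linter.dupNamespace false
set_option autoImplicit false

noncomputable section

open scoped Classical NumberField Pointwise

namespace Summit.BirchSwinnertonDyer.BirchSwinnertonDyer.Cruxes.DefiniteAnchorNonFW.Disproof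

open WeierstrassCurve NumberField IsDedekindDomain Field Module
open Literature.NumberTheory.EllipticCurves Literature.NumberTheory.EllipticCurves.ModularForms
open Literature.NumberTheory.EllipticCurves.Rank1Residual Literature.NumberTheory.GaloisRepresentations Literature.NumberTheory.GaloisCohomology
open Literature.NumberTheory.EllipticCurves.CastellaHsuKunduLeeLiu2025
open Literature.NumberTheory.EllipticCurves.BertoliniDarmon2005
open Literature.NumberTheory.EllipticCurves.AcSigned
open Literature.NumberTheory.Automorphic
open Summit.BirchSwinnertonDyer.BirchSwinnertonDyer.Theorems
open Summit.BirchSwinnertonDyer.BirchSwinnertonDyer.Theorems.AdditiveKoly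
open Summit.BirchSwinnertonDyer.BirchSwinnertonDyer.Theorems.SignedBaseChangeDefiniteAnchorDefs
open Summit.BirchSwinnertonDyer.BirchSwinnertonDyer.Theorems.SignedBaseChangeAcDivAdmdefHowardRigidity
open Summit.BirchSwinnertonDyer.BirchSwinnertonDyer.Theorems.SignedBaseChangeAcDivAdmdefAnchorOfNV
open Summit.BirchSwinnertonDyer.BirchSwinnertonDyer.Theorems.SignedBaseChangeAcDivAdmdefAnchorIffNV

/-! ## §0 The anchor predicate and the crux restated -/

section Anchor

variable (W : WeierstrassCurve ℚ) [W.IsGloballyMinimal] (K : Type) [Field K] [NumberField K] (p N : ℕ) [Fact p.Prime]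

/-- **The anchor at level `n`** — the conclusion of `S` VERBATIM: a definite set-up of type `(N, ∏ n)`, a Gross point, a mod-`p`
`a(E)`-eigenvector off `N·∏n`, non-zero WEIGHTED toric period. [cite: CastellaEtAl2025, §7.4] [cite: WZhang2014, Thm. 9.1] -/
def AnchorAt (n : Finset (AdmQ W K p)) : Prop :=
  ∃ (S : Brandt.XiSetup N (∏ q ∈ n.image Subtype.val, q)) (ψ : K →ₐ[ℚ] S.D) (I : Submodule ℤ S.D)
    (φ : Brandt.ClassSet S.O → ZMod p),
    Brandt.IsGrossPoint S.O ψ I ∧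
    (letI : Fintype (Brandt.ClassSet S.O) := Fintype.ofFinite _
     φ ∈ Brandt.eigenSpace (ZMod p) (N * ∏ q ∈ n.image Subtype.val, q) (Brandt.matrix S.O) (fun ℓ ↦ W.frobeniusTrace ℓ)) ∧
    Brandt.toricPeriod S.O ψ I (fun i ↦ (Brandt.weight S.O i : ZMod p) * φ i) ≠ 0

end Anchor

/-- **§0/§1 The crux, conclusion named; TYPING AUDIT.**  `S ⟺` «cell-β binders ⟹ `AnchorAt W K p N n` at every odd zero vertex» — `Iff.rfl`.
Readback (no junk found): `p : ℕ` with `Fact p.Prime`; `W` globally minimal, so `W.frobeniusTrace ℓ = a_ℓ(E)` and `W.conductorNorm ℤ = N_E`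
(`hN` casts both to `ℤ`); `f : CuspForm Γ₀(N) 2` with `IsNewformOf W f := IsNewform0 f ∧ ∀ n, a_n(f) = (W.LFunction n : ℂ)` (honest newform,
not constructible); `Surj W p := W.HasSurjectiveModNGaloisRep p`; `primesOver … ncard = 2` = split; binder (ii) = `∃` a place `v ∣ q` of `ℚ`,
a prime `𝔓` of `ℚ̄` over it and `σ ∈ I_𝔓` moving a geometric `p`-torsion point (honest «`E[p]` ramified at `q`»); `FWNonsplitRam W p := ∃ q ≠ p`
prime, multiplicative non-split at `q`, `p ∤ v_q(Δ_min)`; `[Module (ZMod p) Vp]` is the unique `𝔽_p`-structure of the `p`-torsion group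
`H¹(K, E[p])` (any such instance has `(n : ZMod p) • x = n • x`); `AdmQ` = BD05 `1`-admissible primes (prime, `∤ pN`, inert, `p ∤ q² − 1`,
`p ∣ q + 1 ∓ a_q`); `SelQP c n μ` = `sgn μ`-eigenspace of `conjAct c` cut by Kummer conditions off `n` and TORIC conditions above `n`;
conclusion: `XiSetup N m` (fields `IsQuaternionAlgebra ℚ D`, `IsTotallyDefinite`, `Squarefree m`, `ramifiedPlaces = primes of m`,
`IsEichlerOrder O N` = intersection of two maximal orders of index `N` — fine at non-square-free `N`), `IsGrossPoint` (optimal embedding of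
`𝓞_K` relative to `O` through the lattice `I`), `eigenSpace (ZMod p) M T a = {v | ∀ ℓ prime, ℓ ∤ M → (T ℓ mod p) *ᵥ v = a ℓ • v}` (anemic, so several
congruent forms only ENLARGE it), `toricPeriod O ψ I φ = ∑_{𝔞 ∈ Pic 𝓞_K} φ(class of 𝔞 ⋆ I)`, `weight O i = [O_iˣ : ℤˣ]` cast to `ZMod p`
(the `w`-weighting matches the `mulVec` (column) eigenvector convention of `Brandt.matrix`, Voight (41.1.1)).  [cite: WZhang2014, §5, Thm. 9.1]
[cite: BertoliniDarmon2005, p. 18] [cite: Gross1987, Prop. 10.3, §11] -/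
theorem definiteAnchorNonFW_iff :
    DefiniteAnchorNonFW ↔
      ∀ {p : ℕ} [Fact p.Prime] (W : WeierstrassCurve ℚ) [W.IsElliptic] [W.IsGloballyMinimal]
        (K : Type) [Field K] [NumberField K] {N : ℕ} [NeZero N] {f : CuspForm (CongruenceSubgroup.Gamma0 N) 2}
        (_ : IsNewformOf W f),
        (N : ℤ) = W.conductorNorm ℤ → 5 ≤ p → W.HasGoodReductionAtPrime p → W.frobeniusTrace p = 0 →
        Surj W p →
        IsImaginaryQuadratic K → ((Ideal.span {(p : ℤ)}).primesOver (𝓞 K)).ncard = 2 →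
        (∀ ℓ : ℕ, ℓ.Prime → ℓ ∣ N → ((Ideal.span {(ℓ : ℤ)}).primesOver (𝓞 K)).ncard = 2) →
        IsCoprime (N : ℤ) (NumberField.discr K) → ¬ p ∣ NumberField.classNumber K →
        ¬ Squarefree N →
        (∀ q : ℕ, q.Prime → q ∣ N →
          ∃ v : HeightOneSpectrum (𝓞 ℚ), ((q : ℕ) : 𝓞 ℚ) ∈ v.asIdeal ∧
            ∃ 𝔓 ∈ v.primesAbove, ∃ σ ∈ 𝔓.inertia (absoluteGaloisGroup ℚ),
              ∃ P : W.geomTorsion (p : ℤ), σ • P ≠ P) →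
        ¬ Summit.BirchSwinnertonDyer.Rank1Residual.Additive.FWNonsplitRam W p →
        ∀ (c : K ≃ₐ[ℚ] K), c ≠ 1 → ∀ [Module (ZMod p) (AdditiveKoly.Vp W K p)],
          ∀ n : Finset (AdditiveKoly.AdmQ W K p), Odd n.card → (∀ μ : Bool, AdditiveKoly.SelQP W K p c n μ = ⊥) →
            AnchorAt W K p N n :=
  Iff.rfl

/-! ## §2 Binders that are NOT load-bearing (kernel) -/

section NotLoadBearing

variable {K : Type} [Field K] [NumberField K] {W : WeierstrassCurve ℚ} [W.IsGloballyMinimal] {p : ℕ}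

omit [NumberField K] in
/-- For a prime `p < 5` there are NO Bertolini–Darmon admissible primes (`p = 2, 3`: clause `p ∤ q² − 1` fails for every prime `q ≠ p`;
tree `three_lt_of_isAdmissiblePrime`). [cite: BertoliniDarmon2005, p. 22 (proof of Thm. 3.2: "p > 3 is needed")] -/
theorem isEmpty_admQ_of_lt_five (hp : p.Prime) (h : p < 5) : IsEmpty (AdmQ W K p) := by
  refine ⟨fun q ↦ ?_⟩
  have h3 := three_lt_of_isAdmissiblePrime hp q.2
  have h4 : p ≠ 4 := by rintro rfl; exact absurd hp (by norm_num)
  omega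

omit [NumberField K] in
/-- Hence for `p < 5` every level is empty and no level is odd: the body of `S` is VACUOUSLY true below `5`. [cite: BertoliniDarmon2005, p. 22] -/
theorem not_odd_card_of_lt_five (hp : p.Prime) (h : p < 5) (n : Finset (AdmQ W K p)) : ¬ Odd n.card := by
  haveI := isEmpty_admQ_of_lt_five (W := W) (K := K) hp h
  rw [Finset.eq_empty_of_isEmpty n, Finset.card_empty]
  exact Nat.not_odd_iff_even.mpr Even.zero

end NotLoadBearing

/-- `S` with the binder `5 ≤ p →` DELETED. [cite: BertoliniDarmon2005, p. 18] -/
def WithoutFiveLe : Prop :=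
  ∀ {p : ℕ} [Fact p.Prime] (W : WeierstrassCurve ℚ) [W.IsElliptic] [W.IsGloballyMinimal]
    (K : Type) [Field K] [NumberField K] {N : ℕ} [NeZero N] {f : CuspForm (CongruenceSubgroup.Gamma0 N) 2}
    (_ : IsNewformOf W f),
    (N : ℤ) = W.conductorNorm ℤ → W.HasGoodReductionAtPrime p → W.frobeniusTrace p = 0 →
    Surj W p →
    IsImaginaryQuadratic K → ((Ideal.span {(p : ℤ)}).primesOver (𝓞 K)).ncard = 2 →
    (∀ ℓ : ℕ, ℓ.Prime → ℓ ∣ N → ((Ideal.span {(ℓ : ℤ)}).primesOver (𝓞 K)).ncard = 2) →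
    IsCoprime (N : ℤ) (NumberField.discr K) → ¬ p ∣ NumberField.classNumber K →
    ¬ Squarefree N →
    (∀ q : ℕ, q.Prime → q ∣ N →
      ∃ v : HeightOneSpectrum (𝓞 ℚ), ((q : ℕ) : 𝓞 ℚ) ∈ v.asIdeal ∧
        ∃ 𝔓 ∈ v.primesAbove, ∃ σ ∈ 𝔓.inertia (absoluteGaloisGroup ℚ),
          ∃ P : W.geomTorsion (p : ℤ), σ • P ≠ P) →
    ¬ Summit.BirchSwinnertonDyer.Rank1Residual.Additive.FWNonsplitRam W p →
    ∀ (c : K ≃ₐ[ℚ] K), c ≠ 1 → ∀ [Module (ZMod p) (AdditiveKoly.Vp W K p)],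
      ∀ n : Finset (AdditiveKoly.AdmQ W K p), Odd n.card → (∀ μ : Bool, AdditiveKoly.SelQP W K p c n μ = ⊥) →
        AnchorAt W K p N n

/-- ★ **`5 ≤ p` is redundant**: `S` with `5 ≤ p →` deleted is EQUIVALENT to `S` (below `5` no level is odd, `not_odd_card_of_lt_five`).
[cite: BertoliniDarmon2005, p. 22] -/
theorem withoutFiveLe_iff : WithoutFiveLe ↔ DefiniteAnchorNonFW := by
  refine ⟨fun h p _ W _ _ K _ _ N _ f hf hN _ hgood hap hsurj hK hsp hHeeg hND hcl hnsf hall hnfw c hc1 _ n hodd hzero ↦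
      h W K hf hN hgood hap hsurj hK hsp hHeeg hND hcl hnsf hall hnfw c hc1 n hodd hzero,
    fun h p _ W _ _ K _ _ N _ f hf hN hgood hap hsurj hK hsp hHeeg hND hcl hnsf hall hnfw c hc1 _ n hodd hzero ↦ ?_⟩
  by_cases h5 : 5 ≤ p
  · exact h W K hf hN h5 hgood hap hsurj hK hsp hHeeg hND hcl hnsf hall hnfw c hc1 n hodd hzero
  · exact absurd hodd (not_odd_card_of_lt_five (Fact.out : p.Prime) (by omega) n)

section AtOne

variable {K : Type} [Field K] [NumberField K] (W : WeierstrassCurve ℚ) [W.IsGloballyMinimal] (p : ℕ)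
  (c : K ≃ₐ[ℚ] K) [Module (ZMod p) (Vp W K p)]

/-- At `c = 1` the `+`-eigen-condition is EMPTY (`conjAct 1 = id`, `id − 1 • id = 0`), so `Sel_n^{+, c=1}` is the sign-free level space and
contains every `SelQP W K p c n μ`. [cite: WZhang2014, §5] -/
theorem selQP_le_selQP_one_true (n : Finset (AdmQ W K p)) (μ : Bool) : SelQP W K p c n μ ≤ SelQP W K p 1 n true := by
  change AddSubgroup.toZModSubmodule p _ ≤ AddSubgroup.toZModSubmodule p _
  refine (OrderIso.le_iff_le _).mpr ?_
  unfold levelSelmerSubgroupP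
  refine inf_le_inf ?_ le_rfl
  have hker : (conjAct W (1 : K ≃ₐ[ℚ] K) ((p ^ 1 : ℕ) : ℤ) - sgnP true • AddMonoidHom.id (Vp W K p)).ker = ⊤ := by
    rw [conjAct_one, sgnP, if_pos rfl, one_smul, sub_self]
    exact AddMonoidHom.ker_zero
  rw [hker]
  exact le_top

end AtOne

/-- `S` at `c := 1` (the instance the binder `c ≠ 1` excludes). [cite: WZhang2014, §5] -/
def AtOne : Prop :=
  ∀ {p : ℕ} [Fact p.Prime] (W : WeierstrassCurve ℚ) [W.IsElliptic] [W.IsGloballyMinimal]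
    (K : Type) [Field K] [NumberField K] {N : ℕ} [NeZero N] {f : CuspForm (CongruenceSubgroup.Gamma0 N) 2}
    (_ : IsNewformOf W f),
    (N : ℤ) = W.conductorNorm ℤ → 5 ≤ p → W.HasGoodReductionAtPrime p → W.frobeniusTrace p = 0 →
    Surj W p →
    IsImaginaryQuadratic K → ((Ideal.span {(p : ℤ)}).primesOver (𝓞 K)).ncard = 2 →
    (∀ ℓ : ℕ, ℓ.Prime → ℓ ∣ N → ((Ideal.span {(ℓ : ℤ)}).primesOver (𝓞 K)).ncard = 2) →
    IsCoprime (N : ℤ) (NumberField.discr K) → ¬ p ∣ NumberField.classNumber K →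
    ¬ Squarefree N →
    (∀ q : ℕ, q.Prime → q ∣ N →
      ∃ v : HeightOneSpectrum (𝓞 ℚ), ((q : ℕ) : 𝓞 ℚ) ∈ v.asIdeal ∧
        ∃ 𝔓 ∈ v.primesAbove, ∃ σ ∈ 𝔓.inertia (absoluteGaloisGroup ℚ),
          ∃ P : W.geomTorsion (p : ℤ), σ • P ≠ P) →
    ¬ Summit.BirchSwinnertonDyer.Rank1Residual.Additive.FWNonsplitRam W p →
    ∀ [Module (ZMod p) (AdditiveKoly.Vp W K p)],
      ∀ n : Finset (AdditiveKoly.AdmQ W K p), Odd n.card → (∀ μ : Bool, AdditiveKoly.SelQP W K p 1 n μ = ⊥) →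
        AnchorAt W K p N n

/-- ★ **`c ≠ 1` protects nothing**: the excluded instance `c = 1` FOLLOWS from `S` — its zero-vertex hypothesis (`Sel^{+,c=1}_n = 0`, the whole
sign-free level space) kills `SelQP c₀ n ±` for the genuine conjugation `c₀ ≠ 1` (which exists, `exists_algEquiv_ne_one_mul_self`), and the
conclusion does not mention `c`. [cite: WZhang2014, §5] [cite: GrossLMS1991, §5] -/
theorem atOne_of (h : DefiniteAnchorNonFW) : AtOne := by
  intro p _ W _ _ K _ _ N _ f hf hN h5 hgood hap hsurj hK hsp hHeeg hND hcl hnsf hall hnfw _ n hodd hzero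
  obtain ⟨c₀, hc₀, -⟩ := hK.exists_algEquiv_ne_one_mul_self
  refine h W K hf hN h5 hgood hap hsurj hK hsp hHeeg hND hcl hnsf hall hnfw c₀ hc₀ n hodd fun μ ↦ ?_
  exact le_bot_iff.mp ((selQP_le_selQP_one_true W p c₀ n μ).trans (hzero true).le)

/-- `S` with the binder pair `{f : CuspForm Γ₀(N) 2} (_ : IsNewformOf W f)` DELETED (no modularity assumed). [cite: BreuilConradDiamondTaylor2001, Thm. A] -/
def WithoutNewform : Prop :=
  ∀ {p : ℕ} [Fact p.Prime] (W : WeierstrassCurve ℚ) [W.IsElliptic] [W.IsGloballyMinimal]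
    (K : Type) [Field K] [NumberField K] {N : ℕ} [NeZero N],
    (N : ℤ) = W.conductorNorm ℤ → 5 ≤ p → W.HasGoodReductionAtPrime p → W.frobeniusTrace p = 0 →
    Surj W p →
    IsImaginaryQuadratic K → ((Ideal.span {(p : ℤ)}).primesOver (𝓞 K)).ncard = 2 →
    (∀ ℓ : ℕ, ℓ.Prime → ℓ ∣ N → ((Ideal.span {(ℓ : ℤ)}).primesOver (𝓞 K)).ncard = 2) →
    IsCoprime (N : ℤ) (NumberField.discr K) → ¬ p ∣ NumberField.classNumber K →
    ¬ Squarefree N →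
    (∀ q : ℕ, q.Prime → q ∣ N →
      ∃ v : HeightOneSpectrum (𝓞 ℚ), ((q : ℕ) : 𝓞 ℚ) ∈ v.asIdeal ∧
        ∃ 𝔓 ∈ v.primesAbove, ∃ σ ∈ 𝔓.inertia (absoluteGaloisGroup ℚ),
          ∃ P : W.geomTorsion (p : ℤ), σ • P ≠ P) →
    ¬ Summit.BirchSwinnertonDyer.Rank1Residual.Additive.FWNonsplitRam W p →
    ∀ (c : K ≃ₐ[ℚ] K), c ≠ 1 → ∀ [Module (ZMod p) (AdditiveKoly.Vp W K p)],
      ∀ n : Finset (AdditiveKoly.AdmQ W K p), Odd n.card → (∀ μ : Bool, AdditiveKoly.SelQP W K p c n μ = ⊥) →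
        AnchorAt W K p N n

/-- ★ **The newform binder is decoration** modulo modularity (`exists_isNewformOf`, Wiles–BCDT + Carayol, a NAMED FACT taken as hypothesis):
nothing in `S` but the binder itself mentions `f`. [cite: BreuilConradDiamondTaylor2001, Thm. A] [cite: Carayol1986] -/
theorem withoutNewform_iff (hmod : exists_isNewformOf) : WithoutNewform ↔ DefiniteAnchorNonFW := by
  refine ⟨fun h p _ W _ _ K _ _ N _ f _ hN ↦ h (p := p) W K hN, fun h p _ W _ _ K _ _ N _ hN ↦ ?_⟩
  have hN' : N = W.conductorNorm ℤ := by exact_mod_cast hN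
  subst hN'
  obtain ⟨f, hf⟩ := hmod W
  exact h W K hf hN

/-- (Anch) on ALL of cell β: `S` with the Fouquet–Wan binder DELETED. [cite: FouquetWan2021, Thm. 5.1] -/
def OnBeta : Prop :=
  ∀ {p : ℕ} [Fact p.Prime] (W : WeierstrassCurve ℚ) [W.IsElliptic] [W.IsGloballyMinimal]
    (K : Type) [Field K] [NumberField K] {N : ℕ} [NeZero N] {f : CuspForm (CongruenceSubgroup.Gamma0 N) 2}
    (_ : IsNewformOf W f),
    (N : ℤ) = W.conductorNorm ℤ → 5 ≤ p → W.HasGoodReductionAtPrime p → W.frobeniusTrace p = 0 →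
    Surj W p →
    IsImaginaryQuadratic K → ((Ideal.span {(p : ℤ)}).primesOver (𝓞 K)).ncard = 2 →
    (∀ ℓ : ℕ, ℓ.Prime → ℓ ∣ N → ((Ideal.span {(ℓ : ℤ)}).primesOver (𝓞 K)).ncard = 2) →
    IsCoprime (N : ℤ) (NumberField.discr K) → ¬ p ∣ NumberField.classNumber K →
    ¬ Squarefree N →
    (∀ q : ℕ, q.Prime → q ∣ N →
      ∃ v : HeightOneSpectrum (𝓞 ℚ), ((q : ℕ) : 𝓞 ℚ) ∈ v.asIdeal ∧
        ∃ 𝔓 ∈ v.primesAbove, ∃ σ ∈ 𝔓.inertia (absoluteGaloisGroup ℚ),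
          ∃ P : W.geomTorsion (p : ℤ), σ • P ≠ P) →
    ∀ (c : K ≃ₐ[ℚ] K), c ≠ 1 → ∀ [Module (ZMod p) (AdditiveKoly.Vp W K p)],
      ∀ n : Finset (AdditiveKoly.AdmQ W K p), Odd n.card → (∀ μ : Bool, AdditiveKoly.SelQP W K p c n μ = ⊥) →
        AnchorAt W K p N n

/-- ★ **The Fouquet–Wan cut is a partition**: (Anch) on β ⟺ `DefiniteAnchorFW ∧ DefiniteAnchorNonFW` (excluded middle on `FWNonsplitRam W p`).
[cite: FouquetWan2021, Thm. 5.1, Cor. 1.10] -/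
theorem onBeta_iff : OnBeta ↔ DefiniteAnchorFW ∧ DefiniteAnchorNonFW := by
  constructor
  · exact fun h ↦ ⟨fun W _ _ K _ _ N _ f hf hN h5 hgood hap hsurj hK hsp hHeeg hND hcl hnsf hall _ ↦
        h W K hf hN h5 hgood hap hsurj hK hsp hHeeg hND hcl hnsf hall,
      fun W _ _ K _ _ N _ f hf hN h5 hgood hap hsurj hK hsp hHeeg hND hcl hnsf hall _ ↦
        h W K hf hN h5 hgood hap hsurj hK hsp hHeeg hND hcl hnsf hall⟩
  · rintro ⟨hFW, hNFW⟩
    intro p _ W _ _ K _ _ N _ f hf hN h5 hgood hap hsurj hK hsp hHeeg hND hcl hnsf hall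
    by_cases hfw : Summit.BirchSwinnertonDyer.Rank1Residual.Additive.FWNonsplitRam W p
    · exact hFW W K hf hN h5 hgood hap hsurj hK hsp hHeeg hND hcl hnsf hall hfw
    · exact hNFW W K hf hN h5 hgood hap hsurj hK hsp hHeeg hND hcl hnsf hall hfw

/-! ## §3 Binders that ARE load-bearing -/

section Odd

variable {K : Type} [Field K] [NumberField K] {W : WeierstrassCurve ℚ} [W.IsGloballyMinimal] {p N : ℕ}

omit [NumberField K] in
/-- **No definite set-up at an EVEN level**: a set-up of type `(N, ∏ n)` is ramified exactly at the `#n` primes of `n` and at `∞`, and the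
number of ramified places of a rational quaternion algebra is even (tree `XiSetup.odd_card_primeFactors`, from Hilbert reciprocity over `ℚ`).
[cite: VignerasLNM800, Ch. III §3 Thm. 3.1] -/
theorem isEmpty_xiSetup_of_even_card {n : Finset (AdmQ W K p)} (hn : Even n.card) :
    IsEmpty (Brandt.XiSetup N (∏ q ∈ n.image Subtype.val, q)) := by
  refine ⟨fun S ↦ ?_⟩
  have hodd := S.odd_card_primeFactors
  rw [prod_image_val_eq_prod, card_primeFactors_prod] at hodd
  exact (Nat.not_even_iff_odd.mpr hodd) hn

/-- ★ **The conclusion of `S` is UNSATISFIABLE at even levels** — `Odd n.card` cannot be dropped as typed (any cell-β datum with an even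
zero vertex would refute the `Odd`-less text); on β it is moreover implied by the zero-vertex hypothesis via Gross–Parson parity (module
docstring §3, conjectural label for the full parity lemma). [cite: VignerasLNM800, Ch. III §3 Thm. 3.1] [cite: GrossParson2012, Lemma 9] -/
theorem not_anchorAt_of_even_card [Fact p.Prime] {n : Finset (AdmQ W K p)} (hn : Even n.card) : ¬ AnchorAt W K p N n := by
  rintro ⟨S, -⟩
  exact (isEmpty_xiSetup_of_even_card (N := N) hn).false S

end Odd

/-- `S` with the zero-vertex binder `(∀ μ, SelQP W K p c n μ = ⊥) →` DELETED: «an anchor at EVERY odd admissible level».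
[cite: WZhang2014, Thm. 9.1] [cite: CastellaEtAl2025, §7.4] -/
def WithoutSelZero : Prop :=
  ∀ {p : ℕ} [Fact p.Prime] (W : WeierstrassCurve ℚ) [W.IsElliptic] [W.IsGloballyMinimal]
    (K : Type) [Field K] [NumberField K] {N : ℕ} [NeZero N] {f : CuspForm (CongruenceSubgroup.Gamma0 N) 2}
    (_ : IsNewformOf W f),
    (N : ℤ) = W.conductorNorm ℤ → 5 ≤ p → W.HasGoodReductionAtPrime p → W.frobeniusTrace p = 0 →
    Surj W p →
    IsImaginaryQuadratic K → ((Ideal.span {(p : ℤ)}).primesOver (𝓞 K)).ncard = 2 →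
    (∀ ℓ : ℕ, ℓ.Prime → ℓ ∣ N → ((Ideal.span {(ℓ : ℤ)}).primesOver (𝓞 K)).ncard = 2) →
    IsCoprime (N : ℤ) (NumberField.discr K) → ¬ p ∣ NumberField.classNumber K →
    ¬ Squarefree N →
    (∀ q : ℕ, q.Prime → q ∣ N →
      ∃ v : HeightOneSpectrum (𝓞 ℚ), ((q : ℕ) : 𝓞 ℚ) ∈ v.asIdeal ∧
        ∃ 𝔓 ∈ v.primesAbove, ∃ σ ∈ 𝔓.inertia (absoluteGaloisGroup ℚ),
          ∃ P : W.geomTorsion (p : ℤ), σ • P ≠ P) →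
    ¬ Summit.BirchSwinnertonDyer.Rank1Residual.Additive.FWNonsplitRam W p →
    ∀ (c : K ≃ₐ[ℚ] K), c ≠ 1 → ∀ [Module (ZMod p) (AdditiveKoly.Vp W K p)],
      ∀ n : Finset (AdditiveKoly.AdmQ W K p), Odd n.card →
        AnchorAt W K p N n

/-- The `SelZero`-less text is a STRENGTHENING of `S`. [folklore] -/
theorem definiteAnchorNonFW_of_withoutSelZero (h : WithoutSelZero) : DefiniteAnchorNonFW :=
  fun W _ _ K _ _ _ _ _ hf hN h5 hgood hap hsurj hK hsp hHeeg hND hcl hnsf hall hnfw c hc1 _ n hodd _ ↦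
    h W K hf hN h5 hgood hap hsurj hK hsp hHeeg hND hcl hnsf hall hnfw c hc1 n hodd

section Frame

variable {K : Type} [Field K] [NumberField K] {W : WeierstrassCurve ℚ} [W.IsElliptic] [W.IsGloballyMinimal] {p : ℕ} [Fact p.Prime]
  {κ : ZpExtension K p} {γ : absoluteGaloisGroup K} {N : ℕ} {ε : ℤˣ} {B : SignedBipartiteSystem W K p κ} {𝔭 𝔭' : HeightOneSpectrum (𝓞 K)}
  (c : K ≃ₐ[ℚ] K) [Module (ZMod p) (Vp W K p)]

/-- ★★ **AN ANCHOR FORCES ITS OWN ZERO VERTEX** (Howard's vanishing direction, kernel modulo CHKLL25's frame as HYPOTHESES): in the frame of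
`…AdmdefAnchorIffNV` — signed bipartite system `hB` at level `N = N_E`, `Setting`, {HLV 3.7 local} `hloc`, `p ≥ 5`, `ρ̄` onto, Heegner
hypothesis, `p` split, `(N, d_K) = 1`, binder (ii), `c ≠ 1`, (Par) `hodd`, the dictionary `hdict` and multiplicity one `hmult` — an anchor at
an ODD level `s` gives `λ_1(∏s)(0) ∈ ℤ_pˣ` and [NV] (`hasUnitLambda_of_anchorAt`), whence `Sel_s^± = 0` (`isUnit_lam_iff_selQP_eq_bot_of_hasUnitLambda'`,
Howard 3.2.3 (c) as an iff: reciprocity + Čebotarev + Tate duality).  So anchors live ONLY at zero vertices.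
[cite: Howard2006, Thm. 3.2.3 (c), Lem. 2.3.4] [cite: CastellaEtAl2025, Thm. 7.4, Thm. 7.5, §7.4] [cite: KimOta2023, Thm. 5.5, Cor. 5.7] -/
theorem selQP_eq_bot_of_anchorAt [NeZero N] (hB : IsSignedBipartiteSystem W K p κ γ N ε B) (hS : Setting W K p κ 𝔭 𝔭')
    (hloc : hatleyLeiVigni2022_lemma37_local_signedCondition_eq_kummer W K p κ 𝔭 𝔭')
    (hN : (N : ℤ) = W.conductorNorm ℤ) (h5 : 5 ≤ p) (hsurj : W.HasSurjectiveModNGaloisRep p)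
    (hHeeg : ∀ ℓ : ℕ, ℓ.Prime → ℓ ∣ N → ((Ideal.span {(ℓ : ℤ)}).primesOver (𝓞 K)).ncard = 2)
    (hsp : ((Ideal.span {(p : ℤ)}).primesOver (𝓞 K)).ncard = 2) (hND : IsCoprime (N : ℤ) (NumberField.discr K))
    (hall : ∀ q : ℕ, q.Prime → q ∣ N → ∃ v' : HeightOneSpectrum (𝓞 ℚ), ((q : ℕ) : 𝓞 ℚ) ∈ v'.asIdeal ∧
      ∃ 𝔓 ∈ v'.primesAbove, ∃ σ ∈ 𝔓.inertia (absoluteGaloisGroup ℚ), ∃ P : W.geomTorsion (p : ℤ), σ • P ≠ P)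
    (hc1 : c ≠ 1) (hodd : Odd (finrank (ZMod p) (SelQP W K p c ∅ true) + finrank (ZMod p) (SelQP W K p c ∅ false)))
    (hdict : ∀ m ∈ defProducts N K (fun ℓ ↦ W.frobeniusTrace ℓ) p 1, ∀ (S : Brandt.XiSetup N m),
      ∃ φ : Brandt.ClassSet S.O → ZMod p, φ ≠ 0 ∧
        (letI : Fintype (Brandt.ClassSet S.O) := Fintype.ofFinite _
         φ ∈ Brandt.eigenSpace (ZMod p) (N * m) (Brandt.matrix S.O) (fun ℓ ↦ W.frobeniusTrace ℓ)) ∧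
        ∀ (ψ : K →ₐ[ℚ] S.D) (I : Submodule ℤ S.D), Brandt.IsGrossPoint S.O ψ I →
          (IsUnit (PowerSeries.constantCoeff (B.lam 1 m)) ↔ Brandt.toricPeriod S.O ψ I (fun i ↦ (Brandt.weight S.O i : ZMod p) * φ i) ≠ 0))
    (hmult : ∀ m ∈ defProducts N K (fun ℓ ↦ W.frobeniusTrace ℓ) p 1, ∀ (S : Brandt.XiSetup N m)
      (φ₁ φ₂ : Brandt.ClassSet S.O → ZMod p),
      (letI : Fintype (Brandt.ClassSet S.O) := Fintype.ofFinite _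
       φ₁ ∈ Brandt.eigenSpace (ZMod p) (N * m) (Brandt.matrix S.O) (fun ℓ ↦ W.frobeniusTrace ℓ)) →
      (letI : Fintype (Brandt.ClassSet S.O) := Fintype.ofFinite _
       φ₂ ∈ Brandt.eigenSpace (ZMod p) (N * m) (Brandt.matrix S.O) (fun ℓ ↦ W.frobeniusTrace ℓ)) →
      φ₁ ≠ 0 → ∃ a : ZMod p, φ₂ = a • φ₁)
    {s : Finset (AdmQ W K p)} (hs : Odd s.card) (hanch : AnchorAt W K p N s) :
    ∀ μ : Bool, SelQP W K p c s μ = ⊥ := by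
  have hN' : N = W.conductorNorm ℤ := by exact_mod_cast hN
  have hH : SatisfiesHeegnerHypothesis (W.conductorNorm ℤ) K := fun ℓ hℓ hℓN ↦ hHeeg ℓ hℓ (hN' ▸ hℓN)
  obtain ⟨hlam, hNV⟩ := hasUnitLambda_of_anchorAt hN hdict hmult hs hanch
  exact (isUnit_lam_iff_selQP_eq_bot_of_hasUnitLambda' c hB hS hloc hN h5 hsurj hH hsp hND hall hc1 hodd hNV hs).mp hlam

/-- ★★ **TARGET (a) `_false_without_selZero` — the zero-vertex binder is LOAD-BEARING** (kernel modulo the frame as HYPOTHESES): ONE cell-β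
datum in CHKLL25's frame with ONE odd admissible level `s` carrying a NON-ZERO eigen-Selmer class (`SelQP W K p c s μ ≠ ⊥`) refutes the
`SelZero`-less text, by `selQP_eq_bot_of_anchorAt`.  On paper such data abound (any `(E, K, p)` on β with `dim_𝔽_p Sel_p(E/K) ≥ 3` has
`dim Sel_q ≥ 2` at every admissible `q`: the conditions at `q` cut at most one dimension) — CONJECTURAL instance, no certificate (the binders
`IsNewformOf`, `Surj`, (ii), `hB` are not constructible in the tree).  WHY `S` ITSELF RESISTS: a counterexample to `S` is a ZERO vertex
WITHOUT anchor — a failure of the rank-0 BSD formula mod `℘_n` for a level-raised definite form at non-square-free level; certifying one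
needs a certified `Sel_q(E[p]/K) = 0`, which no available tool produces (kit budget 0).
[cite: Howard2006, Thm. 3.2.3 (c)] [cite: CastellaEtAl2025, Thm. 7.4, Thm. 7.5, Thm. 7.6, §7.4] [cite: WZhang2014, Prop. 5.4, Thm. 9.1] -/
theorem withoutSelZero_false_of_selQP_ne_bot [NeZero N] (hB : IsSignedBipartiteSystem W K p κ γ N ε B) (hS : Setting W K p κ 𝔭 𝔭')
    (hloc : hatleyLeiVigni2022_lemma37_local_signedCondition_eq_kummer W K p κ 𝔭 𝔭')
    {f : CuspForm (CongruenceSubgroup.Gamma0 N) 2} (hf : IsNewformOf W f)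
    (hN : (N : ℤ) = W.conductorNorm ℤ) (h5 : 5 ≤ p) (hgood : W.HasGoodReductionAtPrime p) (hap : W.frobeniusTrace p = 0)
    (hsurj : Surj W p) (hK : IsImaginaryQuadratic K)
    (hsp : ((Ideal.span {(p : ℤ)}).primesOver (𝓞 K)).ncard = 2)
    (hHeeg : ∀ ℓ : ℕ, ℓ.Prime → ℓ ∣ N → ((Ideal.span {(ℓ : ℤ)}).primesOver (𝓞 K)).ncard = 2)
    (hND : IsCoprime (N : ℤ) (NumberField.discr K)) (hcl : ¬ p ∣ NumberField.classNumber K) (hnsf : ¬ Squarefree N)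
    (hall : ∀ q : ℕ, q.Prime → q ∣ N → ∃ v' : HeightOneSpectrum (𝓞 ℚ), ((q : ℕ) : 𝓞 ℚ) ∈ v'.asIdeal ∧
      ∃ 𝔓 ∈ v'.primesAbove, ∃ σ ∈ 𝔓.inertia (absoluteGaloisGroup ℚ), ∃ P : W.geomTorsion (p : ℤ), σ • P ≠ P)
    (hnfw : ¬ Summit.BirchSwinnertonDyer.Rank1Residual.Additive.FWNonsplitRam W p)
    (hc1 : c ≠ 1) (hodd : Odd (finrank (ZMod p) (SelQP W K p c ∅ true) + finrank (ZMod p) (SelQP W K p c ∅ false)))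
    (hdict : ∀ m ∈ defProducts N K (fun ℓ ↦ W.frobeniusTrace ℓ) p 1, ∀ (S : Brandt.XiSetup N m),
      ∃ φ : Brandt.ClassSet S.O → ZMod p, φ ≠ 0 ∧
        (letI : Fintype (Brandt.ClassSet S.O) := Fintype.ofFinite _
         φ ∈ Brandt.eigenSpace (ZMod p) (N * m) (Brandt.matrix S.O) (fun ℓ ↦ W.frobeniusTrace ℓ)) ∧
        ∀ (ψ : K →ₐ[ℚ] S.D) (I : Submodule ℤ S.D), Brandt.IsGrossPoint S.O ψ I →
          (IsUnit (PowerSeries.constantCoeff (B.lam 1 m)) ↔ Brandt.toricPeriod S.O ψ I (fun i ↦ (Brandt.weight S.O i : ZMod p) * φ i) ≠ 0))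
    (hmult : ∀ m ∈ defProducts N K (fun ℓ ↦ W.frobeniusTrace ℓ) p 1, ∀ (S : Brandt.XiSetup N m)
      (φ₁ φ₂ : Brandt.ClassSet S.O → ZMod p),
      (letI : Fintype (Brandt.ClassSet S.O) := Fintype.ofFinite _
       φ₁ ∈ Brandt.eigenSpace (ZMod p) (N * m) (Brandt.matrix S.O) (fun ℓ ↦ W.frobeniusTrace ℓ)) →
      (letI : Fintype (Brandt.ClassSet S.O) := Fintype.ofFinite _
       φ₂ ∈ Brandt.eigenSpace (ZMod p) (N * m) (Brandt.matrix S.O) (fun ℓ ↦ W.frobeniusTrace ℓ)) →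
      φ₁ ≠ 0 → ∃ a : ZMod p, φ₂ = a • φ₁)
    {s : Finset (AdmQ W K p)} (hs : Odd s.card) {μ : Bool} (hne : SelQP W K p c s μ ≠ ⊥) :
    ¬ WithoutSelZero := fun hK1 ↦
  hne (selQP_eq_bot_of_anchorAt c hB hS hloc hN h5 hsurj hHeeg hsp hND hall hc1 hodd hdict hmult hs
    (hK1 W K hf hN h5 hgood hap hsurj hK hsp hHeeg hND hcl hnsf hall hnfw c hc1 s hs) μ)

end Frame

end Summit.BirchSwinnertonDyer.BirchSwinnertonDyer.Cruxes.DefiniteAnchorNonFW.Disproof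

end
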